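import Literature.AlgebraicGeometry.ComplexMultiplication.CMBalancedWeightSplitting
import Literature.FieldTheory.AlgClosed.AutFixedSubfield
import Literature.NumberTheory.EllipticCurves.LatticeInclusionRigidityProofs
import HarnessLib

/-!
# The imaginary quadratic multiplication `√-d` cut out by a Weil section

Cell `pub-hodgecm2` (COR-CM), count-neutral sub-row A3-CM45-products, file 2a.  HONEST FRAMING: structure theorems
about products of CM abelian varieties; no case of the Hodge conjecture is proved here and `HC_CM` is never
asserted.

Setting: a finite family of realisations `(A_i, ι_i, θ_i)` of CM types `Φ_i` of CM fields `K_i` read on `H¹`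
(`ComplexMultiplication.IsCMTypeRealisation`), their product `B = ⨁_i A_i`, and the index set
`⊔_i Hom(K_i, ℂ)` with its `Aut(ℂ)`-action (`τ • (i, s) = (i, τ ∘ s)`, `ρ = starRingAut` = complex conjugation;
`CorCM/CMBalancedWeightSplitting`).  A «WEIL SECTION» is a weight `S ⊆ ⊔_i Hom(K_i, ℂ)` containing no conjugate
pair, meeting every conjugate pair, and with `τ • S ∈ {S, ρ • S}` for every `τ ∈ Aut(ℂ)` (the second horn of the
dichotomy `CMWeights.mem_pohlmannDivisorSetsAlg_two_or_weilSection`).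

* `exists_ringOfIntegers_sum_mul_apply_ne_zero` — Dedekind/Artin independence of the complex embeddings of a number
  field, in the form «some algebraic INTEGER `α` has `Σ_s c_s s(α) ≠ 0`» (`linearIndependent_monoidHom` + the
  integral basis);
* `exists_intCast_eq_of_forall_ringEquiv` — an `Aut(ℂ)`-fixed algebraic integer of `ℂ` is a rational integer;
* **`exists_sqrt_neg_of_weilSection`** — from a Weil section `S`: an integer `d ≥ 1` and `a_i ∈ 𝓞_{K_i}` with
  `s(a_i) = i√d` for `(i, s) ∈ S` and `s(a_i) = -i√d` otherwise (so `a_i² = -d`): the signed trace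
  `δ = Σ_s ± s(α)` over ONE block transforms under `Aut(ℂ)` by the sign character of `S`, is purely imaginary,
  `δ² ∈ ℤ_{<0}`, and `δ ∈ s(K_i)` for every `(i, s) ∈ S` by the fixed-field property of `Aut(ℂ/s(K_i))`
  (`Complex.mem_subfield_of_forall_ringEquiv`) — i.e. ONE imaginary quadratic field `ℚ(√-d)` embedded compatibly in
  every `K_i`, acting on `B` through `φ_S = ⊕_i ι_i(a_i)`;
* sequel `CorCM/CMWeilSectionEndomorphism`: `φ_S ≫ φ_S = -(d • 𝟙 B)` and the weight line `H^{2m}(B)_S` lies in the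
  `+`-Weil eigen-line `weilClassesPlus B φ_S m d` (van Geemen 4.9); consumer `CorCM/CMProductFourfoldsOfMarkman`.

## References

* [vanGeemen1994HodgeAV] B. van Geemen, *An introduction to the Hodge conjecture for abelian varieties*, LNM 1594, 4.9,
  proof of Thm. 6.12.
* [MoonenZarhin1999LowDim] B. Moonen, Yu. Zarhin, Math. Ann. 315 (1999), Thm. 0.1 and (1.9).
* [Milne2020HodgeClassesAV] J. S. Milne, *Hodge classes on abelian varieties* (2020), 1.2 (a).
* [Cox2013] D. A. Cox, *Galois Theory*, 2nd ed., §10.C (conjugates under `Aut(ℂ)`).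

Provenance: Literature home (namespace `Literature.AlgebraicGeometry.ComplexMultiplication.CMWeights`) of the Summits-side `CorCM/CMWeilSectionSqrt` (cell `pub-hodgecm2`, COR-CM; all its imports are `Literature/`, Mathlib and the already re-homed `CMBalancedWeightSplitting`), which `Literature/` may not import; theorems only, no named fact, no definition. Nothing here bears on `HC_CM`. Lane `lit-hodgefound` (Layer A3: CM types, their Kubota ranks and Galois combinatorics), seat p20.
-/

noncomputable section

open _root_.CategoryTheory _root_.CategoryTheory.Limits NumberField

namespace Literature.AlgebraicGeometry.ComplexMultiplication.CMWeights

open Literature.AlgebraicGeometry.Motives (AbelianVariety CMType IsSmoothProjective ComplexPoints)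
open Literature.AlgebraicGeometry.HodgeTheory
open Literature.AlgebraicGeometry.Pohlmann1968
open Literature.AlgebraicGeometry.ComplexMultiplication (IsCMTypeRealisation)
open Literature.AlgebraicTopology.SingularHomology
open Literature.NumberTheory.ComplexMultiplication
open Literature.FieldTheory.AlgClosed

open scoped Classical Pointwise

/-! ### §1 Descent over `Aut(ℂ)` and independence of embeddings -/

section Descent

/-- **An `Aut(ℂ)`-fixed algebraic integer of `ℂ` is a rational integer** (rational by the tree's
`EllipticCurves.exists_ratCast_eq_of_forall_ringEquiv`, and `ℤ` is integrally closed). [cite: Dodson1984, §3.2] -/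
theorem exists_intCast_eq_of_forall_ringEquiv {x : ℂ} (h : ∀ σ : ℂ ≃+* ℂ, σ x = x) (hx : IsIntegral ℤ x) :
    ∃ m : ℤ, (m : ℂ) = x := by
  obtain ⟨q, rfl⟩ := Literature.NumberTheory.EllipticCurves.exists_ratCast_eq_of_forall_ringEquiv h
  have hq : IsIntegral ℤ q := by
    have e : (algebraMap ℚ ℂ).toIntAlgHom q = (q : ℂ) := rfl
    rw [← e] at hx
    exact (isIntegral_algHom_iff _ (algebraMap ℚ ℂ).injective).1 hx
  obtain ⟨m, hm⟩ := (IsIntegrallyClosed.isIntegral_iff (R := ℤ) (K := ℚ)).1 hq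
  exact ⟨m, by rw [← hm]; simp⟩

/-- **Independence of the complex embeddings of a number field, integral form**: if the coefficients `c_s`
(`s : K → ℂ`) are not all zero, some algebraic INTEGER `α ∈ 𝓞_K` has `Σ_s c_s · s(α) ≠ 0` (Dedekind–Artin
independence of characters, Mathlib `linearIndependent_monoidHom`, and `𝓞_K` spans `K` over `ℚ`). [cite: Dodson1984, §3.2] -/
theorem exists_ringOfIntegers_sum_mul_apply_ne_zero {K : Type} [Field K] [NumberField K] (c : (K →+* ℂ) → ℂ)
    (hc : c ≠ 0) : ∃ α : 𝓞 K, ∑ s, c s * s (α : K) ≠ 0 := by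
  by_contra h
  simp only [not_exists, not_not] at h
  -- the relation holds on all of `K` (integral basis)
  have key : ∀ β : K, ∑ s : K →+* ℂ, c s * s β = 0 := by
    intro β
    rw [← (integralBasis K).sum_repr β]
    simp only [map_sum, Finset.mul_sum]
    rw [Finset.sum_comm]
    refine Finset.sum_eq_zero fun j _ => ?_
    have hj := h (RingOfIntegers.basis K j)
    have e : ∀ s : K →+* ℂ, c s * s (((integralBasis K).repr β j) • integralBasis K j) =
        ((integralBasis K).repr β j : ℂ) * (c s * s (RingOfIntegers.basis K j : K)) := by
      intro s
      rw [map_rat_smul, Rat.smul_def, integralBasis_apply]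
      change c s * (((integralBasis K).repr β j : ℂ) * s (RingOfIntegers.basis K j : K)) = _
      ring
    simp_rw [e]
    rw [← Finset.mul_sum, hj, mul_zero]
  -- independence of the embeddings as functions `K → ℂ`
  have hli : LinearIndependent ℂ (fun s : K →+* ℂ => ((s.toMonoidHom : K →* ℂ) : K → ℂ)) :=
    (linearIndependent_monoidHom K ℂ).comp (fun s : K →+* ℂ => s.toMonoidHom) fun s t hst =>
      RingHom.ext fun x => by simpa using DFunLike.congr_fun hst x
  have hsum : ∑ s : K →+* ℂ, c s • ((s.toMonoidHom : K →* ℂ) : K → ℂ) = 0 := by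
    funext β
    simpa [Finset.sum_apply, Pi.smul_apply, smul_eq_mul] using key β
  exact hc (funext fun s => Fintype.linearIndependent_iff.1 hli c hsum s)

end Descent

/-! ### §2 The element `√-d` cut out by a Weil section -/

section WeilSection

variable {n : ℕ} {K : Fin n → Type} [∀ i, Field (K i)] [∀ i, NumberField (K i)]

/-- A number field is countable (a finite-dimensional `ℚ`-vector space). [cite: Dodson1984, §3.2] -/
theorem countable_field (i : Fin n) : Countable (K i) :=
  Countable.of_equiv _ (Module.finBasis ℚ (K i)).equivFun.toEquiv.symm

omit [∀ i, NumberField (K i)] in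
/-- For a Weil section `S`, a translate `τ • S` meeting `S` equals `S` (the alternative `τ • S = ρ • S` would put a
conjugate pair inside `S`). [cite: Dodson1984, §3.2] -/
theorem smul_finset_eq_of_mem_of_weilSection {S : Finset ((i : Fin n) × (K i →+* ℂ))}
    (hsec : ∀ x ∈ S, (starRingAut : ℂ ≃+* ℂ) • x ∉ S)
    (hW : ∀ τ : ℂ ≃+* ℂ, τ • S = S ∨ τ • S = (starRingAut : ℂ ≃+* ℂ) • S)
    {τ : ℂ ≃+* ℂ} {x : (i : Fin n) × (K i →+* ℂ)} (hx : x ∈ S) (hτx : τ • x ∈ S) : τ • S = S := by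
  rcases hW τ with h | h
  · exact h
  · exfalso
    have hmem : τ • x ∈ (starRingAut : ℂ ≃+* ℂ) • S := h ▸ Finset.smul_mem_smul_finset hx
    obtain ⟨y, hy, hyx⟩ := Finset.mem_smul_finset.1 hmem
    have : (starRingAut : ℂ ≃+* ℂ) • (τ • x) = y := by rw [← hyx, conj_smul_conj_smul]
    exact hsec (τ • x) hτx (this ▸ hy)

omit [∀ i, NumberField (K i)] in
/-- For a nonempty Weil section, `ρ • S ≠ S`. [cite: Dodson1984, §3.2] -/
theorem conj_smul_finset_ne_of_weilSection {S : Finset ((i : Fin n) × (K i →+* ℂ))} (hS0 : S.Nonempty)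
    (hsec : ∀ x ∈ S, (starRingAut : ℂ ≃+* ℂ) • x ∉ S) : (starRingAut : ℂ ≃+* ℂ) • S ≠ S := by
  obtain ⟨x, hx⟩ := hS0
  intro h
  exact hsec x hx (h ▸ Finset.smul_mem_smul_finset hx)

/-- **The sign character of a Weil section and its signed trace.**  For a Weil section `S`, a block `i₀` and
`α ∈ 𝓞_{K_{i₀}}`, the signed trace `δ = Σ_s ε_s s(α)` (`ε_s = 1` if `(i₀, s) ∈ S`, `-1` otherwise) satisfies
`τ(δ) = δ` when `τ • S = S` and `τ(δ) = -δ` when `τ • S = ρ • S` (reindex the sum by `s ↦ τ • s`).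
 [cite: Dodson1984, §3.2] -/
theorem ringEquiv_apply_signedTrace {S : Finset ((i : Fin n) × (K i →+* ℂ))}
    (hsec : ∀ x ∈ S, (starRingAut : ℂ ≃+* ℂ) • x ∉ S)
    (hfull : ∀ x : (i : Fin n) × (K i →+* ℂ), x ∈ S ∨ (starRingAut : ℂ ≃+* ℂ) • x ∈ S)
    (i₀ : Fin n) (α : K i₀) (τ : ℂ ≃+* ℂ) :
    (τ • S = S → τ (∑ s : K i₀ →+* ℂ, (if (⟨i₀, s⟩ : (i : Fin n) × (K i →+* ℂ)) ∈ S then (1 : ℂ) else -1) * s α) =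
      ∑ s : K i₀ →+* ℂ, (if (⟨i₀, s⟩ : (i : Fin n) × (K i →+* ℂ)) ∈ S then (1 : ℂ) else -1) * s α) ∧
    (τ • S = (starRingAut : ℂ ≃+* ℂ) • S →
      τ (∑ s : K i₀ →+* ℂ, (if (⟨i₀, s⟩ : (i : Fin n) × (K i →+* ℂ)) ∈ S then (1 : ℂ) else -1) * s α) =
      -∑ s : K i₀ →+* ℂ, (if (⟨i₀, s⟩ : (i : Fin n) × (K i →+* ℂ)) ∈ S then (1 : ℂ) else -1) * s α) := by
  -- `τ` applied to the sum, reindexed by `s ↦ τ • s`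
  have hτsum : τ (∑ s : K i₀ →+* ℂ, (if (⟨i₀, s⟩ : (i : Fin n) × (K i →+* ℂ)) ∈ S then (1 : ℂ) else -1) * s α) =
      ∑ s : K i₀ →+* ℂ, (if (⟨i₀, τ⁻¹ • s⟩ : (i : Fin n) × (K i →+* ℂ)) ∈ S then (1 : ℂ) else -1) * s α := by
    rw [map_sum]
    rw [← Equiv.sum_comp (MulAction.toPerm τ : Equiv.Perm (K i₀ →+* ℂ))
      (fun s => (if (⟨i₀, τ⁻¹ • s⟩ : (i : Fin n) × (K i →+* ℂ)) ∈ S then (1 : ℂ) else -1) * s α)]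
    refine Finset.sum_congr rfl fun s _ => ?_
    simp only [MulAction.toPerm_apply, inv_smul_smul, map_mul]
    congr 1
    · split_ifs <;> simp
  have hmemτ : ∀ s : K i₀ →+* ℂ,
      ((⟨i₀, τ⁻¹ • s⟩ : (i : Fin n) × (K i →+* ℂ)) ∈ S ↔ (⟨i₀, s⟩ : (i : Fin n) × (K i →+* ℂ)) ∈ τ • S) := by
    intro s
    rw [← Finset.inv_smul_mem_iff]
    rfl
  constructor
  · intro hτS
    rw [hτsum]
    refine Finset.sum_congr rfl fun s _ => ?_
    by_cases hs : (⟨i₀, s⟩ : (i : Fin n) × (K i →+* ℂ)) ∈ S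
    · rw [if_pos hs, if_pos ((hmemτ s).2 (by rw [hτS]; exact hs))]
    · rw [if_neg hs, if_neg (fun h => hs (by have h' := (hmemτ s).1 h; rwa [hτS] at h'))]
  · intro hτS
    rw [hτsum, ← Finset.sum_neg_distrib]
    refine Finset.sum_congr rfl fun s _ => ?_
    have hflip : ((⟨i₀, τ⁻¹ • s⟩ : (i : Fin n) × (K i →+* ℂ)) ∈ S) ↔ (⟨i₀, s⟩ : (i : Fin n) × (K i →+* ℂ)) ∉ S := by
      rw [hmemτ s, hτS, ← Finset.inv_smul_mem_iff]
      have e : (starRingAut : ℂ ≃+* ℂ)⁻¹ • (⟨i₀, s⟩ : (i : Fin n) × (K i →+* ℂ)) =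
          (starRingAut : ℂ ≃+* ℂ) • (⟨i₀, s⟩ : (i : Fin n) × (K i →+* ℂ)) := by
        rw [inv_smul_eq_iff, conj_smul_conj_smul]
      rw [e]
      constructor
      · intro h1 h2
        exact hsec _ h2 h1
      · intro h1
        exact (hfull _).resolve_left h1
    by_cases hs : (⟨i₀, s⟩ : (i : Fin n) × (K i →+* ℂ)) ∈ S
    · rw [if_pos hs, if_neg (fun h => (hflip.1 h) hs)]
      ring
    · rw [if_neg hs, if_pos (hflip.2 hs)]
      ring

/-- **The imaginary quadratic element cut out by a Weil section.**  For a nonempty Weil section `S` of a family of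
CM fields `K_i`: there are `d ≥ 1` and `a_i ∈ 𝓞_{K_i}` with `s(a_i) = i√d` for `(i, s) ∈ S` and `s(a_i) = -i√d` for
`(i, s) ∉ S`; in particular `a_i² = -d` in every block — one imaginary quadratic field `ℚ(√-d)`, embedded in every
`K_i` compatibly with `S`.  (Signed trace over one block, `Aut(ℂ)`-equivariance by the sign character of `S`,
`δ² ∈ ℤ_{<0}` by descent, `δ ∈ s(K_i)` by the fixed field of `Aut(ℂ/s(K_i))`, transport to the other embeddings
by the transitivity of `Aut(ℂ)` on `Hom(K_i, ℂ)`.) [cite: Dodson1984, §3.2] -/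
theorem exists_sqrt_neg_of_weilSection {S : Finset ((i : Fin n) × (K i →+* ℂ))} (hS0 : S.Nonempty)
    (hsec : ∀ x ∈ S, (starRingAut : ℂ ≃+* ℂ) • x ∉ S)
    (hfull : ∀ x : (i : Fin n) × (K i →+* ℂ), x ∈ S ∨ (starRingAut : ℂ ≃+* ℂ) • x ∈ S)
    (hW : ∀ τ : ℂ ≃+* ℂ, τ • S = S ∨ τ • S = (starRingAut : ℂ ≃+* ℂ) • S) :
    ∃ (d : ℕ) (a : ∀ i, 𝓞 (K i)), 0 < d ∧
      (∀ x : (i : Fin n) × (K i →+* ℂ), x ∈ S → x.2 (a x.1 : K x.1) = Complex.I * (Real.sqrt d : ℂ)) ∧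
      (∀ x : (i : Fin n) × (K i →+* ℂ), x ∉ S → x.2 (a x.1 : K x.1) = -(Complex.I * (Real.sqrt d : ℂ))) ∧
      ∀ i, (a i) * (a i) = -(d : 𝓞 (K i)) := by
  obtain ⟨⟨i₀, s₀⟩, hx₀⟩ := hS0
  -- the signed trace `δ₀`
  set ε : (K i₀ →+* ℂ) → ℂ := fun s => if (⟨i₀, s⟩ : (i : Fin n) × (K i →+* ℂ)) ∈ S then (1 : ℂ) else -1 with hε
  have hεne : ε ≠ 0 := fun h => by
    have h1 : ε s₀ = 0 := congrFun h s₀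
    rw [hε] at h1
    dsimp only at h1
    rw [if_pos hx₀] at h1
    exact one_ne_zero h1
  obtain ⟨α, hα⟩ := exists_ringOfIntegers_sum_mul_apply_ne_zero ε hεne
  set δ₀ : ℂ := ∑ s : K i₀ →+* ℂ, ε s * s (α : K i₀) with hδ₀
  have hρS : (starRingAut : ℂ ≃+* ℂ) • S ≠ S := conj_smul_finset_ne_of_weilSection ⟨_, hx₀⟩ hsec
  -- transformation under `Aut(ℂ)`
  have hfix : ∀ τ : ℂ ≃+* ℂ, τ • S = S → τ δ₀ = δ₀ := fun τ hτ =>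
    (ringEquiv_apply_signedTrace hsec hfull i₀ (α : K i₀) τ).1 hτ
  have hflip : ∀ τ : ℂ ≃+* ℂ, τ • S = (starRingAut : ℂ ≃+* ℂ) • S → τ δ₀ = -δ₀ := fun τ hτ =>
    (ringEquiv_apply_signedTrace hsec hfull i₀ (α : K i₀) τ).2 hτ
  have hsq_fix : ∀ τ : ℂ ≃+* ℂ, τ (δ₀ * δ₀) = δ₀ * δ₀ := by
    intro τ
    rw [map_mul]
    rcases hW τ with h | h
    · rw [hfix τ h]
    · rw [hflip τ h, neg_mul_neg]
  have hconj : starRingEnd ℂ δ₀ = -δ₀ := hflip starRingAut ((hW starRingAut).resolve_left hρS)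
  -- integrality
  have hδint : IsIntegral ℤ δ₀ := by
    refine IsIntegral.sum _ fun s _ => IsIntegral.mul ?_ ?_
    · rw [hε]
      dsimp only
      split_ifs
      · exact isIntegral_one
      · exact isIntegral_one.neg
    · exact (RingOfIntegers.isIntegral_coe α).map s.toIntAlgHom
  -- `δ₀² = -d`, `d ≥ 1`
  obtain ⟨m, hm⟩ := exists_intCast_eq_of_forall_ringEquiv hsq_fix (hδint.mul hδint)
  have hre : δ₀.re = 0 := by
    have := congrArg Complex.re hconj
    simp only [Complex.conj_re, Complex.neg_re] at this
    linarith
  have him : δ₀.im ≠ 0 := fun h => hα (Complex.ext (by simp [hre]) (by simp [h]))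
  have hm_eq : (m : ℝ) = -(δ₀.im * δ₀.im) := by
    have := congrArg Complex.re hm
    simp only [Complex.intCast_re, Complex.mul_re, hre, zero_mul, zero_sub] at this
    linarith
  have hm_neg : m < 0 := by
    have h1 : 0 < δ₀.im * δ₀.im := mul_self_pos.2 him
    have h2 : (m : ℝ) < 0 := by rw [hm_eq]; linarith
    exact_mod_cast h2
  set d : ℕ := (-m).toNat with hd
  have hd_pos : 0 < d := by omega
  have hmd : (m : ℂ) = -(d : ℂ) := by
    have : ((-m).toNat : ℤ) = -m := Int.toNat_of_nonneg (by omega)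
    have h' : (d : ℤ) = -m := by rw [hd]; exact this
    have h'' : (m : ℤ) = -(d : ℤ) := by omega
    exact_mod_cast congrArg (fun z : ℤ => (z : ℂ)) h''
  have hδ₀sq : δ₀ * δ₀ = -(d : ℂ) := by rw [← hm, hmd]
  -- normalise the sign: `δ = i√d`
  set δ : ℂ := if 0 < δ₀.im then δ₀ else -δ₀ with hδdef
  have hδ_or : δ = δ₀ ∨ δ = -δ₀ := by rw [hδdef]; split_ifs <;> simp
  have hδ_eq : δ = Complex.I * (Real.sqrt d : ℂ) := by
    have hdim : δ.im * δ.im = d ∧ 0 < δ.im ∧ δ.re = 0 := by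
      have hsq : δ₀.im * δ₀.im = d := by
        have := congrArg Complex.re hδ₀sq
        simp only [Complex.mul_re, hre, zero_mul, zero_sub, Complex.neg_re, Complex.natCast_re] at this
        linarith
      rw [hδdef]
      split_ifs with h
      · exact ⟨hsq, h, hre⟩
      · refine ⟨by simpa using hsq, ?_, by simp [hre]⟩
        simp only [Complex.neg_im, Left.neg_pos_iff]
        exact lt_of_le_of_ne (not_lt.1 h) him
    obtain ⟨h1, h2, h3⟩ := hdim
    have h4 : δ.im = Real.sqrt d := by
      rw [eq_comm, Real.sqrt_eq_iff_mul_self_eq_of_pos h2]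
      exact h1
    refine Complex.ext ?_ ?_
    · simp [h3]
    · simp [h4]
  have hδfix : ∀ τ : ℂ ≃+* ℂ, τ • S = S → τ δ = δ := fun τ hτ => by
    rcases hδ_or with h | h
    · rw [h, hfix τ hτ]
    · rw [h, map_neg, hfix τ hτ]
  have hδint' : IsIntegral ℤ δ := by
    rcases hδ_or with h | h
    · rw [h]; exact hδint
    · rw [h]; exact hδint.neg
  have hδsq : δ * δ = -(d : ℂ) := by
    rcases hδ_or with h | h
    · rw [h, hδ₀sq]
    · rw [h, neg_mul_neg, hδ₀sq]
  -- a base embedding in `S` for every block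
  have hSi : ∀ i : Fin n, ∃ s : K i →+* ℂ, (⟨i, s⟩ : (i : Fin n) × (K i →+* ℂ)) ∈ S := by
    intro i
    obtain ⟨s⟩ : Nonempty (K i →+* ℂ) := inferInstance
    rcases hfull ⟨i, s⟩ with h | h
    · exact ⟨s, h⟩
    · refine ⟨ComplexEmbedding.conjugate s, ?_⟩
      rw [conj_smul_sigma_eq] at h
      exact h
  choose sI hsI using hSi
  -- `δ ∈ sI i (K i)` by the fixed field of `Aut(ℂ / sI i (K i))`
  have hδmem : ∀ i, δ ∈ (sI i).fieldRange := by
    intro i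
    haveI : Countable (K i) := countable_field i
    have hcount : Cardinal.mk (sI i).fieldRange ≤ Cardinal.aleph0 := by
      have hc : ((sI i).fieldRange : Set ℂ).Countable := by
        rw [RingHom.coe_fieldRange]
        exact Set.countable_range _
      haveI : Countable (sI i).fieldRange := hc.to_subtype
      exact Cardinal.mk_le_aleph0
    refine Complex.mem_subfield_of_forall_ringEquiv (sI i).fieldRange hcount fun σ hσ => ?_
    have hσs : σ • sI i = sI i := RingHom.ext fun b => hσ _ ((sI i).mem_fieldRange.2 ⟨b, rfl⟩)
    have hσx : σ • (⟨i, sI i⟩ : (i : Fin n) × (K i →+* ℂ)) ∈ S := by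
      rw [smul_sigma_eq]
      change (⟨i, σ • sI i⟩ : (i : Fin n) × (K i →+* ℂ)) ∈ S
      rw [hσs]
      exact hsI i
    exact hδfix σ (smul_finset_eq_of_mem_of_weilSection hsec hW (hsI i) hσx)
  have haex : ∀ i, ∃ a : 𝓞 (K i), sI i (a : K i) = δ := by
    intro i
    obtain ⟨b, hb⟩ := (sI i).mem_fieldRange.1 (hδmem i)
    have hbint : IsIntegral ℤ b := by
      rw [← hb] at hδint'
      exact (isIntegral_algHom_iff (sI i).toIntAlgHom (sI i).injective).1 hδint'
    exact ⟨⟨b, hbint⟩, hb⟩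
  choose a ha using haex
  -- values on all embeddings
  have hval : ∀ x : (i : Fin n) × (K i →+* ℂ), x ∈ S → x.2 (a x.1 : K x.1) = δ := by
    rintro ⟨i, s⟩ hs
    haveI : Countable (K i) := countable_field i
    obtain ⟨τ, hτ⟩ := Literature.AlgebraicGeometry.Motives.ZarhinLie.exists_ringEquiv_complex_comp_eq (sI i) s
    have hτs : τ • sI i = s := RingHom.ext fun b => hτ b
    have hτx : τ • (⟨i, sI i⟩ : (i : Fin n) × (K i →+* ℂ)) ∈ S := by
      rw [smul_sigma_eq]
      change (⟨i, τ • sI i⟩ : (i : Fin n) × (K i →+* ℂ)) ∈ S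
      rw [hτs]
      exact hs
    have hτS := smul_finset_eq_of_mem_of_weilSection hsec hW (hsI i) hτx
    change s (a i : K i) = δ
    rw [← hτ, ha i, hδfix τ hτS]
  have hval' : ∀ x : (i : Fin n) × (K i →+* ℂ), x ∉ S → x.2 (a x.1 : K x.1) = -δ := by
    rintro ⟨i, s⟩ hs
    have hcs : (starRingAut : ℂ ≃+* ℂ) • (⟨i, s⟩ : (i : Fin n) × (K i →+* ℂ)) ∈ S := (hfull _).resolve_left hs
    have h1 := hval _ hcs
    rw [conj_smul_sigma_eq] at h1
    change ComplexEmbedding.conjugate s (a i : K i) = δ at h1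
    rw [ComplexEmbedding.conjugate_coe_eq] at h1
    change s (a i : K i) = -δ
    have h2 : s (a i : K i) = starRingEnd ℂ δ := by rw [← h1, starRingEnd_self_apply]
    rw [h2]
    have hδconj : starRingEnd ℂ δ = -δ := by
      rw [hδ_eq]
      simp [Complex.conj_ofReal]
    exact hδconj
  refine ⟨d, a, hd_pos, fun x hx => by rw [hval x hx, hδ_eq], fun x hx => by rw [hval' x hx, hδ_eq], fun i => ?_⟩
  -- `a_i² = -d`
  apply RingOfIntegers.eq_iff.1
  apply (sI i).injective
  change sI i (algebraMap (𝓞 (K i)) (K i) (a i * a i)) = sI i (algebraMap (𝓞 (K i)) (K i) (-(d : 𝓞 (K i))))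
  rw [map_mul, map_mul, map_neg, map_natCast, map_neg, map_natCast]
  change sI i (a i : K i) * sI i (a i : K i) = _
  rw [ha i, hδsq]

end WeilSection

end Literature.AlgebraicGeometry.ComplexMultiplication.CMWeights

end
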